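import Summits.QuantumFields.BalabanUV.Beta.FP.RemainderLedger
import Summits.QuantumFields.BalabanUV.Beta.FP.HorizontalRemainderPerfectCov

/-!
# `BalabanUV.Beta.FP.RemainderLedgerCov` — road «FP» for binder row D1, row GAMMA-8 under RULING R-FP-32: THE (rem) LEDGER ENDs ON THE PRINTED REFLECTION COVARIANCE —
# `FP/RemainderLedger.hbook∕hasym_perfect_of_pieces` with the unfillable evenness letter `heven` REPLACED by `hcov : AxisReflectionCovariant (flipK K)`; everything else VERBATIM

HONEST DEPENDENCY (page 1, mandatory): continuum YM on T⁴ ⇐ BetaPertH ∧ nine spine estimates (0/9 proved); BetaPertH ⇐ (D1) ∧ (D4) ∧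
CAP+tail; G-an2-4 gates asym, D1 and NE2/3/4.  HONEST FRAMING (cell contract, verbatim): «discharging `BetaPertH` makes Bałaban's UV
stability UNCONDITIONAL — a real constructive-QFT result; it is NOT the continuum limit and NOT the Clay problem.»  THIS MODULE is [folklore]
composition BY NAME of the owner's ledger algebra `FP/RemainderLedger.rem_of_split` (finite-sum bookkeeping, untouched) and the covariant ENDs
`FP/HorizontalRemainderPerfectCov.hbook∕hasym_perfect_of_remainder_cov`.  No `def`, no `def … : Prop`, nothing cited, 0 sorry; 0 estimates of Bałaban's objects;
0∕4 row-D1 binders; NOT hbook, NOT hasym, NOT D1, NOT BetaPertH, NOT continuum, NOT Clay.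

ABSOLUTE RULE (cell charter, verbatim): «No internally-minted statement may enter as a cited fact. Every hypothesis is either kernel-proved in this
package or a verbatim quotation of a PUBLISHED theorem with page reference. The manuscript(s) under audit are NOT citable for their own disputed
steps — they are the thing under adjudication; programme-internal (2001/route/tribunal) claims are never citable.»

WITH THIS FILE, road FP's (ASYMP) at the perfect columns is BY TYPE a function of exactly {(K6), **(Kcov)** `AxisReflectionCovariant (flipK K)`, (K0) for `K = PiBF` [H2-ASM-5∕5a],
`hsplit` [KER-γ (α)], the piece ledger [(rem) suppliers], `hgerm` [H2-ASM-5]} — the list of R-FP-30 as CORRECTED by E-FP-8-2.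
Unit `b2b-balaban-beta-d1-formalise-leaf-01` (gen 10), drafted for the road OWNER d1-p3 (R-FP-32 named these twins his; filed by whichever seat the owner names).
-/

noncomputable section

namespace Summit.QuantumFields.BalabanUV.Beta.FP.RemainderLedgerCov

open Finset Filter Topology
open scoped BigOperators
open Literature.Probability.LatticeModels (box annulus)
open Literature.MathematicalPhysics.QuantumFieldTheory.Balaban1983to89
open Literature.MathematicalPhysics.QuantumFieldTheory.Balaban1983to89.Beta
open DyadicShell (Pt supNorm)
open PolarizationSign (AxisReflectionCovariant)
open OneStepKernelFamily (flipK)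
open DressedMomentNormalisation (EKer dressedEntry)
open Summit.QuantumFields.BalabanUV.Beta.GAN24.CombesThomas (sfStep smStep)
open Summit.QuantumFields.BalabanUV.Beta.FP.PerfectObjectsT (KPerf)
open Summit.QuantumFields.BalabanUV.Beta.FP.TransportInfinityM (colOf)
open Summit.QuantumFields.BalabanUV.Beta.FP.HorizontalBookkeeping (truncK)
open Summit.QuantumFields.BalabanUV.Beta.FP.RemainderLedger (rem_of_split)
open Summit.QuantumFields.BalabanUV.Beta.FP.HorizontalRemainderPerfectCov (hbook_perfect_of_remainder_cov hasym_perfect_of_remainder_cov)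

section Perfect

variable {Lc : ℕ} [NeZero Lc]

/-- **`hbook` AT THE PERFECT COLUMNS FROM A PIECE LEDGER, COVARIANT FORM** [our object] (`d = 3`, `2 ≤ Lc`): three kernel letters of `K` (sextic decay,
`AxisReflectionCovariant (flipK K)`, `HasSum (K c e) 0`), a split `T m μ ν v − Xtr_m v = Σ_{i∈I} D i m v` for every `m ≥ 1`, and m-UNIFORM per-piece (rem) bounds
`B i` give an m-FREE `U₀ ≥ 0` with `|secondMoment (T m) μ ν − Σ_{0<‖z‖∞≤Lc^m} K μ ν z·z_μ·z_ν| ≤ U₀ + Σ_{i∈I} B i` for every `m ≥ 1`. -/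
theorem hbook_perfect_of_pieces_cov (hLc : 2 ≤ Lc) {K : EKer 4} {C : ℝ}
    (hK : ∀ c' e (t : Pt), |K c' e t| ≤ C / ((supNorm t : ℝ) + 1) ^ 6)
    (hcov : AxisReflectionCovariant (flipK K)) (hK0 : ∀ c' e, HasSum (K c' e) 0)
    {T : ℕ → Fin 4 → Fin 4 → Pt → ℝ} (μ ν : Fin 4) {ι : Type*} (I : Finset ι) {D : ι → ℕ → Pt → ℝ} {B : ι → ℝ}
    (hsplit : ∀ m : ℕ, 1 ≤ m → ∀ v : Pt,
      T m μ ν v - ((Lc ^ m : ℕ) : ℝ) ^ 8 * dressedEntry (colOf (KPerf (d := 3) Lc (sfStep Lc) (smStep 3 Lc) m))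
          (truncK K (Lc ^ m)) (((Lc ^ m : ℕ) : ℤ) • v) μ ν = ∑ i ∈ I, D i m v)
    (hpieces : ∀ i ∈ I, ∀ m : ℕ, 1 ≤ m → ∀ S : Finset Pt, ∑ v ∈ S, (supNorm v : ℝ) ^ 2 * |D i m v| ≤ B i) :
    ∃ U₀ : ℝ, 0 ≤ U₀ ∧ ∀ m : ℕ, 1 ≤ m →
      (Summable fun v : Pt => T m μ ν v * (v μ : ℝ) * (v ν : ℝ)) ∧
      |B12Beta.secondMoment (T m) μ ν - ∑ z ∈ annulus 4 0 (Lc ^ m), K μ ν z * (z μ : ℝ) * (z ν : ℝ)| ≤ U₀ + ∑ i ∈ I, B i :=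
  hbook_perfect_of_remainder_cov hLc hK hcov hK0 (T := T) μ ν fun m hm =>
    rem_of_split (T := T m) I (hsplit m hm) (fun i hi => hpieces i hi m hm)

/-- **`hasym` AT THE PERFECT COLUMNS FROM A PIECE LEDGER, COVARIANT FORM** [our object] (`d = 3`, `2 ≤ Lc`): `hbook_perfect_of_pieces_cov` plus `hgerm` ⟹
`∃ U₀ ≥ 0`, m-free, `|secondMoment (T m) μ ν − m·(s·log Lc)| ≤ (U₀ + Σ_{i∈I} B i) + Cg + |c₀|` for every `m ≥ 1` — road FP's (ASYMP) at the perfect columns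
as a function of EXACTLY: (K6), (Kcov), (K0), the split, the piece ledger, `hgerm`. -/
theorem hasym_perfect_of_pieces_cov (hLc : 2 ≤ Lc) {K : EKer 4} {C : ℝ}
    (hK : ∀ c' e (t : Pt), |K c' e t| ≤ C / ((supNorm t : ℝ) + 1) ^ 6)
    (hcov : AxisReflectionCovariant (flipK K)) (hK0 : ∀ c' e, HasSum (K c' e) 0)
    {T : ℕ → Fin 4 → Fin 4 → Pt → ℝ} (μ ν : Fin 4) {ι : Type*} (I : Finset ι) {D : ι → ℕ → Pt → ℝ} {B : ι → ℝ}
    (hsplit : ∀ m : ℕ, 1 ≤ m → ∀ v : Pt,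
      T m μ ν v - ((Lc ^ m : ℕ) : ℝ) ^ 8 * dressedEntry (colOf (KPerf (d := 3) Lc (sfStep Lc) (smStep 3 Lc) m))
          (truncK K (Lc ^ m)) (((Lc ^ m : ℕ) : ℤ) • v) μ ν = ∑ i ∈ I, D i m v)
    (hpieces : ∀ i ∈ I, ∀ m : ℕ, 1 ≤ m → ∀ S : Finset Pt, ∑ v ∈ S, (supNorm v : ℝ) ^ 2 * |D i m v| ≤ B i)
    {s c₀ Cg : ℝ}
    (hgerm : ∀ M : ℕ, 1 ≤ M → |∑ z ∈ annulus 4 0 M, K μ ν z * (z μ : ℝ) * (z ν : ℝ) - (s * Real.log M + c₀)| ≤ Cg) :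
    ∃ U₀ : ℝ, 0 ≤ U₀ ∧ ∀ m : ℕ, 1 ≤ m →
      |B12Beta.secondMoment (T m) μ ν - (m : ℝ) * (s * Real.log Lc)| ≤ (U₀ + ∑ i ∈ I, B i) + Cg + |c₀| :=
  hasym_perfect_of_remainder_cov hLc hK hcov hK0 (T := T) μ ν
    (fun m hm => rem_of_split (T := T m) I (hsplit m hm) (fun i hi => hpieces i hi m hm)) hgerm

end Perfect

end Summit.QuantumFields.BalabanUV.Beta.FP.RemainderLedgerCov

end
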